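import Mathlib
import Summits.AtomisticToContinuum.Crystallization.Theorems.ChartedPlanarOrderEnvelopeWalkSums

/-!
# Envelope transport for `ChartedZeroExcessLayered` — part 3/4: the ENERGY transport clause

For a point-stationary law of the envelope class the walked root energy `W_μ^n[x ↦ (∫ V_LJ ‖y − x‖ ∂μ)/2](0)` is
`P`-integrable and has the same mean as the root energy (`energy_transport_clause`, the (A) clause of the stub
`stub_walkTransportEnvS` VERBATIM): positivity splitting through the clamped `rootEnergy'`, the separated-sum bound of part 2,
Mecke re-rooting and the intensity preservation of part 1.
-/

set_option maxHeartbeats 800000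

namespace Summit.AtomisticToContinuum.Crystallization.Theorems.ChartedPlanarOrderEnvelopeTransport

open MeasureTheory Literature.Geometry.DiscreteGeometry Literature.Probability.Process
open Literature.MathematicalPhysics.StatisticalMechanics
open Summit.AtomisticToContinuum.Crystallization.Theorems.ChartedPlanarOrderBondWalkTransport
open Summit.AtomisticToContinuum.Crystallization.Theorems.ChartedPlanarOrderPatternWalkHyps
open scoped ENNReal
open Summit.AtomisticToContinuum.Crystallization.Theorems.ChartedPlanarOrderDefectEventGeometry

/-! ## Stage 3 — the ENERGY TRANSPORT clause of Tc̄ / Tc̄ˢ as a theorem -/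

/-- The bond window about `0` is a measurable set. -/
theorem measurableSet_bondWindow :
    MeasurableSet {v : EuclideanSpace ℝ (Fin 3) | 0 < dist (0 : EuclideanSpace ℝ (Fin 3)) v ∧
      dist (0 : EuclideanSpace ℝ (Fin 3)) v ≤ 28 / 25} :=
  (measurableSet_lt measurable_const (measurable_const.dist measurable_id)).inter
    (measurableSet_le (measurable_const.dist measurable_id) measurable_const)

/-- The engine's configuration-walk functional `μ ↦ W_μ^n (y ↦ F (θ_y μ)) (0)` is a.e.-measurable under a law carried by
rooted separated configurations (kernel version of the walk, `measurable_rootWalkStepK`, agrees a.e.). -/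
theorem aemeasurable_confWalk {δ : ℝ} (hδ : 0 < δ)
    {P : Measure (Measure (EuclideanSpace ℝ (Fin 3)))}
    (hroot : ∀ᵐ μ ∂P, ∃ S : Set (EuclideanSpace ℝ (Fin 3)), (0 : EuclideanSpace ℝ (Fin 3)) ∈ S ∧
      (∀ x ∈ S, ∀ y ∈ S, x ≠ y → δ ≤ dist x y) ∧
      μ = (Measure.count : Measure (EuclideanSpace ℝ (Fin 3))).restrict S)
    {F : Measure (EuclideanSpace ℝ (Fin 3)) → ℝ≥0∞} (hF : Measurable F) (n : ℕ) :
    AEMeasurable (fun μ : Measure (EuclideanSpace ℝ (Fin 3)) =>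
      ((fun (h : EuclideanSpace ℝ (Fin 3) → ℝ≥0∞) (x : EuclideanSpace ℝ (Fin 3)) =>
        (12 : ℝ≥0∞)⁻¹ * ∫⁻ y, ((fun y => y - x) ⁻¹'
          {v : EuclideanSpace ℝ (Fin 3) | 0 < dist (0 : EuclideanSpace ℝ (Fin 3)) v ∧
            dist (0 : EuclideanSpace ℝ (Fin 3)) v ≤ 28 / 25}).indicator h y ∂μ)^[n]
        (fun y => F (Measure.map (fun z => z - y) μ))) 0) P := by
  obtain ⟨κ, hκ, hκid⟩ := exists_isSFiniteKernel_apply_eq_self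
    (fun n : ℕ => (fun z : EuclideanSpace ℝ (Fin 3) => ⌊‖z‖⌋₊) ⁻¹' {n}) measurableSet_floorNorm_preimage
    (fun i j hij => Set.disjoint_iff.2 fun z hz => hij (hz.1.symm.trans hz.2))
    (fun z => ⟨⌊‖z‖⌋₊, rfl⟩)
  haveI := hκ
  set B := {v : EuclideanSpace ℝ (Fin 3) | 0 < dist (0 : EuclideanSpace ℝ (Fin 3)) v ∧
      dist (0 : EuclideanSpace ℝ (Fin 3)) v ≤ 28 / 25} with hB
  have hBm : MeasurableSet B := measurableSet_bondWindow
  have hmeasK : ∀ m : ℕ, Measurable ((fun (G : Measure (EuclideanSpace ℝ (Fin 3)) → ℝ≥0∞)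
      (ν : Measure (EuclideanSpace ℝ (Fin 3))) =>
      (12 : ℝ≥0∞)⁻¹ * ∫⁻ y, B.indicator (fun y => G (Measure.map (fun z => z - y) (κ ν))) y ∂(κ ν))^[m] F) := by
    intro m
    induction m with
    | zero => simpa using hF
    | succ m ih =>
      rw [Function.iterate_succ_apply']
      exact measurable_rootWalkStepK κ hBm _ ih
  refine ⟨_, hmeasK n, ?_⟩
  filter_upwards [ae_floorNorm_lt_top_of_rooted hδ hroot] with μ hμ
  rw [← iterate_rootWalkStep_eq_confWalk B (12 : ℝ≥0∞)⁻¹ F μ n, ← iterate_rootWalkStepK_eq κ hκid B _ F n μ hμ]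

/-- At a point `x` of a `δ`-separated `S`, the surrogate evaluated at the re-rooted configuration IS the Bochner site
energy `(∫ y, V_LJ ‖y - x‖ ∂count|S)/2`, and the latter is bounded by `M(δ)/2`. -/
theorem rootEnergy'_map_sub {S : Set (EuclideanSpace ℝ (Fin 3))} {δ : ℝ} (hδ : 0 < δ)
    (hsep : ∀ x ∈ S, ∀ y ∈ S, x ≠ y → δ ≤ dist x y) {x : EuclideanSpace ℝ (Fin 3)} (hx : x ∈ S) :
    rootEnergy' (Measure.map (fun z => z - x)
        ((Measure.count : Measure (EuclideanSpace ℝ (Fin 3))).restrict S))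
      = (∫ y, lennardJones ‖y - x‖ ∂((Measure.count : Measure (EuclideanSpace ℝ (Fin 3))).restrict S)) / 2
    ∧ |(∫ y, lennardJones ‖y - x‖ ∂((Measure.count : Measure (EuclideanSpace ℝ (Fin 3))).restrict S)) / 2|
      ≤ ljBound δ / 2 := by
  have measurable_lennardJones : Measurable lennardJones := by
    show Measurable fun r : ℝ => (1 / 12) * (r⁻¹) ^ 12 - (1 / 6) * (r⁻¹) ^ 6
    exact ((measurable_inv.pow_const 12).const_mul _).sub ((measurable_inv.pow_const 6).const_mul _)
  have h1 : Measurable fun y : EuclideanSpace ℝ (Fin 3) => ENNReal.ofReal (lennardJones ‖y‖) :=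
    ENNReal.measurable_ofReal.comp (measurable_lennardJones.comp measurable_norm)
  have h2 : Measurable fun y : EuclideanSpace ℝ (Fin 3) => ENNReal.ofReal (- lennardJones ‖y‖) :=
    ENNReal.measurable_ofReal.comp ((measurable_lennardJones.comp measurable_norm).neg)
  have hfm : Measurable fun y : EuclideanSpace ℝ (Fin 3) => lennardJones ‖y - x‖ :=
    measurable_lennardJones.comp (measurable_sub_const x).norm
  have hlin : ∫⁻ y, ENNReal.ofReal |lennardJones ‖y - x‖|
      ∂((Measure.count : Measure (EuclideanSpace ℝ (Fin 3))).restrict S) ≤ ENNReal.ofReal (ljBound δ) := by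
    have hb := lintegral_abs_lennardJones_le hδ hsep hx
    calc ∫⁻ y, ENNReal.ofReal |lennardJones ‖y - x‖|
          ∂((Measure.count : Measure (EuclideanSpace ℝ (Fin 3))).restrict S)
        = ∫⁻ y, ENNReal.ofReal |lennardJones (dist x y)|
          ∂((Measure.count : Measure (EuclideanSpace ℝ (Fin 3))).restrict S) :=
          lintegral_congr fun y => by rw [dist_eq_norm, norm_sub_rev]
      _ ≤ ENNReal.ofReal (ljBound δ) := hb
  have hint : Integrable (fun y : EuclideanSpace ℝ (Fin 3) => lennardJones ‖y - x‖)
      ((Measure.count : Measure (EuclideanSpace ℝ (Fin 3))).restrict S) := by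
    refine ⟨hfm.aestronglyMeasurable, ?_⟩
    show ∫⁻ y, ‖lennardJones ‖y - x‖‖ₑ ∂((Measure.count : Measure (EuclideanSpace ℝ (Fin 3))).restrict S) < ⊤
    calc ∫⁻ y, ‖lennardJones ‖y - x‖‖ₑ ∂((Measure.count : Measure (EuclideanSpace ℝ (Fin 3))).restrict S)
        = ∫⁻ y, ENNReal.ofReal |lennardJones ‖y - x‖|
          ∂((Measure.count : Measure (EuclideanSpace ℝ (Fin 3))).restrict S) :=
          lintegral_congr fun y => by rw [Real.enorm_eq_ofReal_abs]
      _ ≤ ENNReal.ofReal (ljBound δ) := hlin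
      _ < ⊤ := ENNReal.ofReal_lt_top
  have hbound : |(∫ y, lennardJones ‖y - x‖
      ∂((Measure.count : Measure (EuclideanSpace ℝ (Fin 3))).restrict S)) / 2| ≤ ljBound δ / 2 := by
    have hn := norm_integral_le_lintegral_norm (μ := ((Measure.count : Measure (EuclideanSpace ℝ (Fin 3))).restrict S))
      (fun y : EuclideanSpace ℝ (Fin 3) => lennardJones ‖y - x‖)
    have hle : (∫⁻ y, ENNReal.ofReal ‖lennardJones ‖y - x‖‖
        ∂((Measure.count : Measure (EuclideanSpace ℝ (Fin 3))).restrict S)).toReal ≤ ljBound δ := by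
      refine ENNReal.toReal_le_of_le_ofReal (ljBound_nonneg hδ) ?_
      calc ∫⁻ y, ENNReal.ofReal ‖lennardJones ‖y - x‖‖
            ∂((Measure.count : Measure (EuclideanSpace ℝ (Fin 3))).restrict S)
          = ∫⁻ y, ENNReal.ofReal |lennardJones ‖y - x‖|
            ∂((Measure.count : Measure (EuclideanSpace ℝ (Fin 3))).restrict S) :=
            lintegral_congr fun y => by rw [Real.norm_eq_abs]
        _ ≤ ENNReal.ofReal (ljBound δ) := hlin
    rw [Real.norm_eq_abs] at hn
    rw [abs_div, abs_of_pos (by norm_num : (0:ℝ) < 2)]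
    linarith
  refine ⟨?_, hbound⟩
  unfold rootEnergy'
  rw [lintegral_map h1 (measurable_sub_const x), lintegral_map h2 (measurable_sub_const x),
    integral_eq_lintegral_pos_part_sub_lintegral_neg_part hint]

/-- **ENERGY TRANSPORT CLAUSE** of Tc̄ / Tc̄ˢ (identical in both typings) as a THEOREM: for a point-stationary law of the
envelope class, the `n`-step REAL bond walk of the site energy started at the root is `P`-integrable and has mean equal to
the mean root site energy.  Proof: uniform Lennard-Jones bound on separated sets; identification of the real walk with the
engine's `ℝ≥0∞` walk of `ofReal (rootEnergy' + M)`; the transport engine; Bochner ↔ `lintegral` conversions. -/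
theorem energy_transport_clause {δ : ℝ} (hδ : 0 < δ)
    (P : Measure (Measure (EuclideanSpace ℝ (Fin 3)))) (hP : IsProbabilityMeasure P)
    (hroot : ∀ᵐ μ ∂P, ∃ S : Set (EuclideanSpace ℝ (Fin 3)), (0 : EuclideanSpace ℝ (Fin 3)) ∈ S ∧
      (∀ x ∈ S, ∀ y ∈ S, x ≠ y → δ ≤ dist x y) ∧
      μ = (Measure.count : Measure (EuclideanSpace ℝ (Fin 3))).restrict S)
    (hMecke : ∀ g : Measure (EuclideanSpace ℝ (Fin 3)) → EuclideanSpace ℝ (Fin 3) → ℝ≥0∞,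
      Measurable (Function.uncurry g) →
      ∫⁻ μ, ∫⁻ y, g μ y ∂μ ∂P = ∫⁻ μ, ∫⁻ y, g (Measure.map (fun z => z - y) μ) (-y) ∂μ ∂P)
    (hclean : ∀ᵐ μ ∂P, ∀ q : EuclideanSpace ℝ (Fin 3), μ {q} ≠ 0 → (∃ a : ℝ, 9 / 10 ≤ a ∧ a ≤ 1 ∧
      ∃ (A : EuclideanSpace ℝ (Fin 3) →ₗᵢ[ℝ] EuclideanSpace ℝ (Fin 3)) (T : Finset (EuclideanSpace ℝ (Fin 3)))
        (f : EuclideanSpace ℝ (Fin 3) → EuclideanSpace ℝ (Fin 3)),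
        (T = fccTwoShellPattern ∨ T = hcpTwoShellPattern) ∧
        (∀ v ∈ T, f v ∈ {p : EuclideanSpace ℝ (Fin 3) | μ {p} ≠ 0} ∧ dist (f v) (q + a • A v) ≤ 1 / 16 * a) ∧
        Set.InjOn f ↑T ∧
        ∀ y ∈ {p : EuclideanSpace ℝ (Fin 3) | μ {p} ≠ 0}, y ≠ q → dist y q < 3 / 2 * a → ∃ v ∈ T, f v = y))
    (n : ℕ) :
    MeasureTheory.Integrable (fun μ : MeasureTheory.Measure (EuclideanSpace ℝ (Fin 3)) =>
      (((fun f : EuclideanSpace ℝ (Fin 3) → ℝ => fun x : EuclideanSpace ℝ (Fin 3) =>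
        (1 / 12 : ℝ) * ∫ y, (if 0 < dist x y ∧ dist x y ≤ 28 / 25 then f y else 0) ∂μ)^[n])
        (fun x : EuclideanSpace ℝ (Fin 3) =>
          (∫ y, Literature.MathematicalPhysics.StatisticalMechanics.lennardJones ‖y - x‖ ∂μ) / 2)
        (0 : EuclideanSpace ℝ (Fin 3)))) P ∧
    (∫ μ, (((fun f : EuclideanSpace ℝ (Fin 3) → ℝ => fun x : EuclideanSpace ℝ (Fin 3) =>
        (1 / 12 : ℝ) * ∫ y, (if 0 < dist x y ∧ dist x y ≤ 28 / 25 then f y else 0) ∂μ)^[n])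
        (fun x : EuclideanSpace ℝ (Fin 3) =>
          (∫ y, Literature.MathematicalPhysics.StatisticalMechanics.lennardJones ‖y - x‖ ∂μ) / 2)
        (0 : EuclideanSpace ℝ (Fin 3))) ∂P)
      = (∫ μ, (∫ y, Literature.MathematicalPhysics.StatisticalMechanics.lennardJones ‖y‖ ∂μ) / 2 ∂P) := by
  have measurable_rootEnergy' : Measurable rootEnergy' := by
    have measurable_lennardJones : Measurable lennardJones := by
      show Measurable fun r : ℝ => (1 / 12) * (r⁻¹) ^ 12 - (1 / 6) * (r⁻¹) ^ 6
      exact ((measurable_inv.pow_const 12).const_mul _).sub ((measurable_inv.pow_const 6).const_mul _)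
    have h1 : Measurable fun y : EuclideanSpace ℝ (Fin 3) => ENNReal.ofReal (lennardJones ‖y‖) :=
      ENNReal.measurable_ofReal.comp (measurable_lennardJones.comp measurable_norm)
    have h2 : Measurable fun y : EuclideanSpace ℝ (Fin 3) => ENNReal.ofReal (- lennardJones ‖y‖) :=
      ENNReal.measurable_ofReal.comp ((measurable_lennardJones.comp measurable_norm).neg)
    unfold rootEnergy'
    exact (((Measure.measurable_lintegral h1).ennreal_toReal).sub
      ((Measure.measurable_lintegral h2).ennreal_toReal)).div_const 2
  haveI := hP
  -- constants and the root functional fed to the engine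
  set M : ℝ := ljBound δ / 2 with hM
  have hM0 : 0 ≤ M := by rw [hM]; exact div_nonneg (ljBound_nonneg hδ) zero_le_two
  set F : Measure (EuclideanSpace ℝ (Fin 3)) → ℝ≥0∞ := fun ν => ENNReal.ofReal (rootEnergy' ν + M) with hFdef
  have hFm : Measurable F := ENNReal.measurable_ofReal.comp (measurable_rootEnergy'.add_const M)
  -- the three functionals of the law
  set A : Measure (EuclideanSpace ℝ (Fin 3)) → ℝ := fun μ =>
      (((fun f : EuclideanSpace ℝ (Fin 3) → ℝ => fun x : EuclideanSpace ℝ (Fin 3) =>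
        (1 / 12 : ℝ) * ∫ y, (if 0 < dist x y ∧ dist x y ≤ 28 / 25 then f y else 0) ∂μ)^[n])
        (fun x : EuclideanSpace ℝ (Fin 3) =>
          (∫ y, Literature.MathematicalPhysics.StatisticalMechanics.lennardJones ‖y - x‖ ∂μ) / 2)
        (0 : EuclideanSpace ℝ (Fin 3))) with hA
  set Wn : Measure (EuclideanSpace ℝ (Fin 3)) → ℝ≥0∞ := fun μ =>
      ((fun (h : EuclideanSpace ℝ (Fin 3) → ℝ≥0∞) (x : EuclideanSpace ℝ (Fin 3)) =>
        (12 : ℝ≥0∞)⁻¹ * ∫⁻ y, ((fun y => y - x) ⁻¹'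
          {v : EuclideanSpace ℝ (Fin 3) | 0 < dist (0 : EuclideanSpace ℝ (Fin 3)) v ∧
            dist (0 : EuclideanSpace ℝ (Fin 3)) v ≤ 28 / 25}).indicator h y ∂μ)^[n]
        (fun y => F (Measure.map (fun z => z - y) μ))) 0 with hWn
  set e : Measure (EuclideanSpace ℝ (Fin 3)) → ℝ := fun μ =>
      (∫ y, Literature.MathematicalPhysics.StatisticalMechanics.lennardJones ‖y‖ ∂μ) / 2 with he
  -- deterministic identification on the good set
  have hgood : ∀ᵐ μ ∂P, Wn μ = ENNReal.ofReal (A μ + M) ∧ |A μ| ≤ M ∧ rootEnergy' μ = e μ ∧ |e μ| ≤ M := by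
    filter_upwards [hroot, hclean] with μ hμ hcl
    obtain ⟨S, h0S, hsep, rfl⟩ := hμ
    have hS : MeasurableSet S := (countable_of_separated hδ hsep).measurableSet
    have hfin : ∀ x : EuclideanSpace ℝ (Fin 3), (Metric.closedBall x (28 / 25) ∩ S).Finite := fun x =>
      Literature.Probability.Process.LocalConfig.finite_inter_of_separated hδ hsep (isCompact_closedBall x _)
    have h12 : ∀ q ∈ S, ((Measure.count : Measure (EuclideanSpace ℝ (Fin 3))).restrict S)
        {y | 0 < dist q y ∧ dist q y ≤ 28 / 25} = 12 := fun q hq =>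
      count_bondShell_eq_twelve q (hcl q ((count_restrict_singleton_ne_zero_iff S q).2 hq))
    have hg : ∀ y ∈ S, (fun y => F (Measure.map (fun z => z - y)
        ((Measure.count : Measure (EuclideanSpace ℝ (Fin 3))).restrict S))) y
        = ENNReal.ofReal ((fun x : EuclideanSpace ℝ (Fin 3) =>
          (∫ y, Literature.MathematicalPhysics.StatisticalMechanics.lennardJones ‖y - x‖
            ∂((Measure.count : Measure (EuclideanSpace ℝ (Fin 3))).restrict S)) / 2) y + M) := by
      intro y hy
      simp only [hFdef]
      rw [(rootEnergy'_map_sub hδ hsep hy).1]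
    have hfM : ∀ y ∈ S, |(fun x : EuclideanSpace ℝ (Fin 3) =>
          (∫ y, Literature.MathematicalPhysics.StatisticalMechanics.lennardJones ‖y - x‖
            ∂((Measure.count : Measure (EuclideanSpace ℝ (Fin 3))).restrict S)) / 2) y| ≤ M := by
      intro y hy
      exact (rootEnergy'_map_sub hδ hsep hy).2
    have hid := walk_enn_eq_ofReal_walk_real hS hfin h12 _ M hfM _ hg n 0 h0S
    have he0 := rootEnergy'_map_sub hδ hsep h0S
    refine ⟨hid.1, hid.2, ?_, ?_⟩
    · have : rootEnergy' ((Measure.count : Measure (EuclideanSpace ℝ (Fin 3))).restrict S)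
          = rootEnergy' (Measure.map (fun z => z - (0 : EuclideanSpace ℝ (Fin 3)))
            ((Measure.count : Measure (EuclideanSpace ℝ (Fin 3))).restrict S)) := by
        rw [map_sub_zero']
      rw [this, he0.1]
      simp only [he, sub_zero]
    · have h2 := he0.2
      simp only [sub_zero] at h2
      simpa only [he] using h2
  -- measurability and integrability
  have hAEM : AEMeasurable Wn P := aemeasurable_confWalk hδ hroot hFm n
  have hA_ae : A =ᵐ[P] fun μ => (Wn μ).toReal - M := by
    filter_upwards [hgood] with μ h
    have hnn : 0 ≤ A μ + M := by
      have := h.2.1; rw [abs_le] at this; linarith [this.1]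
    rw [h.1, ENNReal.toReal_ofReal hnn]; ring
  have hASM_A : AEStronglyMeasurable A P :=
    (hAEM.ennreal_toReal.sub aemeasurable_const).aestronglyMeasurable.congr hA_ae.symm
  have hInt_A : Integrable A P :=
    Integrable.mono' (integrable_const M) hASM_A (by
      filter_upwards [hgood] with μ h
      rw [Real.norm_eq_abs]; exact h.2.1)
  have he_ae : rootEnergy' =ᵐ[P] e := by
    filter_upwards [hgood] with μ h
    exact h.2.2.1
  have hASM_e : AEStronglyMeasurable e P :=
    measurable_rootEnergy'.aestronglyMeasurable.congr he_ae
  have hInt_e : Integrable e P :=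
    Integrable.mono' (integrable_const M) hASM_e (by
      filter_upwards [hgood] with μ h
      rw [Real.norm_eq_abs]; exact h.2.2.2)
  -- the transport identity
  have hengine : ∫⁻ μ, Wn μ ∂P = ∫⁻ μ, F μ ∂P :=
    lintegral_bondWalk_iterate_of_envelope' hδ hMecke hroot hclean hFm n
  have hnnA : 0 ≤ᵐ[P] fun μ => A μ + M := by
    filter_upwards [hgood] with μ h
    have := h.2.1; rw [abs_le] at this
    simp only [Pi.zero_apply]; linarith [this.1]
  have hsmA : AEStronglyMeasurable (fun μ => A μ + M) P := (hInt_A.add (integrable_const M)).aestronglyMeasurable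
  have h1 : ∫ μ, (A μ + M) ∂P = (∫⁻ μ, Wn μ ∂P).toReal := by
    rw [integral_eq_lintegral_of_nonneg_ae hnnA hsmA]
    congr 1
    refine lintegral_congr_ae ?_
    filter_upwards [hgood] with μ h
    rw [h.1]
  have hnne : 0 ≤ᵐ[P] fun μ => e μ + M := by
    filter_upwards [hgood] with μ h
    have := h.2.2.2; rw [abs_le] at this
    simp only [Pi.zero_apply]; linarith [this.1]
  have hsme : AEStronglyMeasurable (fun μ => e μ + M) P := (hInt_e.add (integrable_const M)).aestronglyMeasurable
  have h3 : (∫⁻ μ, F μ ∂P).toReal = ∫ μ, (e μ + M) ∂P := by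
    rw [integral_eq_lintegral_of_nonneg_ae hnne hsme]
    congr 1
    refine lintegral_congr_ae ?_
    filter_upwards [hgood] with μ h
    simp only [hFdef]
    rw [h.2.2.1]
  have h4 : ∫ μ, (A μ + M) ∂P = ∫ μ, (e μ + M) ∂P := by rw [h1, hengine, h3]
  have h5 : ∫ μ, (A μ + M) ∂P = (∫ μ, A μ ∂P) + M := by
    rw [integral_add hInt_A (integrable_const M), integral_const]
    simp
  have h6 : ∫ μ, (e μ + M) ∂P = (∫ μ, e μ ∂P) + M := by
    rw [integral_add hInt_e (integrable_const M), integral_const]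
    simp
  refine ⟨hInt_A, ?_⟩
  have h7 : ∫ μ, A μ ∂P = ∫ μ, e μ ∂P := by linarith [h4, h5, h6]
  simpa only [hA, he] using h7

end Summit.AtomisticToContinuum.Crystallization.Theorems.ChartedPlanarOrderEnvelopeTransport
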